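import Summits.QuantumFields.YangMills.Theorems.CovariantDischargeFramedPlaquetteTransport
import Summits.QuantumFields.YangMills.Theorems.CovariantDischargeSweepActionVariation
import HarnessLib

/-!
# Line «sandwich_discharge» on crux `HistoryTailL` (stmt-QuantumFields-19936), stub `stub_sandwichSweepGapCapped` — (r2) summed:
# THE ACTION CHANGE OF A COVARIANTLY FRAMED ONE-AXIS SWEEP is cost + torque + frame defect, plaquette by plaquette, with nothing else

Cell `ym3-torus` (YM ladder rung R3 = continuum SU(2) Yang–Mills on the three-torus — a RUNG, NOT the Clay problem: not d = 4, not
infinite volume, not a mass gap), width seat `ym-ust-19936-w5` gen 14, helper letters `--supports stmt-QuantumFields-19936`.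

The sweep of the capped stub is the bondwise left product `Ψ′V = E·V` (✓`ApproxLift.mulField`; B2′/B2″) with FRAMED ONE-AXIS factors
`E_b = expPoint(c_b • Ad_{G(b.src)} n̂₀)` (`c_b` the amplitude, `= 0` off the swept set; `G(y) ∈ SU(2)` the frame transport at the site `y`,
`‖n̂₀‖ = 1`).  ✓`CovariantDischargeSweepActionVariation.wilsonAction4_sub_mulField_eq_sum` writes `A(V) − A(E·V)` as the plaquette sum of
`reTr((E·V)(∂q)) − reTr V(∂q)`, and ✓`CovariantDischargeFramedPlaquetteTransport.abs_wilsonTerm_plaq_framed_sub_le` evaluates each term.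
THIS FILE puts the two together:

* §1 per plaquette, in `mulField` letters (`abs_wilsonTerm_plaq_mulField_framed_sub_le`): with the lattice curl of the amplitude
  `s_q := c(b₁) + c(b₂) − c(b₃) − c(b₄)`,
  `|[(1 − reTr (E·V)(∂q)) − (1 − reTr V(∂q))] − [(1 − cos s_q)·reTr V(∂q) + sin s_q·⟨Ad_{G(x)} n̂₀, imVec(su2Quat V(∂q))⟩]| ≤ def_q`,
  `def_q := 2(|c(b₂)|·dist1(G(x)⁻¹V(b₁)G(x+e_μ)) + |c(b₃)|·dist1(G(x)⁻¹(V(b₁)V(b₂)V(b₃)⁻¹)G(x+e_ν)) + |c(b₄)|·dist1 V(∂q))`.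
* §2 summed (★★`abs_wilsonAction4_sub_mulField_framed_le`):
  `|A(V) − A(E·V) + Σ_q [(1 − cos s_q)·reTr V(∂q) + sin s_q·⟨Ad_{G(x)} n̂₀, imVec(su2Quat V(∂q))⟩]| ≤ Σ_q def_q`, and the one-sided
  `hgap`-ready form ★★`framed_lin_sub_le_wilsonAction4_sub_mulField`:
  `Σ_q [−sin s_q·⟨…⟩ − (1 − cos s_q)·reTr V(∂q)] − Σ_q def_q ≤ A(V) − A(E·V)` — NO second-order remainder beyond the exact trigonometry.
* §3 scalar letters for the knit: `(1 − cos s)·r ≤ s²/2` for `r ≤ 1`, `|sin s − s| ≤ |s|³` for `|s| ≤ 1` (private), hence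
  ★`framed_quadratic_sub_le_wilsonAction4_sub_mulField`: `Σ_q [−s_q·⟨…⟩ − |s_q|³·|⟨…⟩| − s_q²/2] − Σ_q def_q ≤ A(V) − A(E·V)`.

WHAT THIS IS NOT.  No profile, no frames are constructed, no `η_R`; the signal `Σ_q s_q·⟨…⟩` is not evaluated ((Z-e)/(M2)/(M3)'s business);
nothing of `stub_sandwichSweepGapCapped`, `HistoryTailL`, the rung R3, d = 4, a continuum limit or a mass gap is proved.  YM₃ on T³ is rung R3,
NOT Clay.  References: T. Bałaban, CMP **109** (1987) 249–301 [Balaban1987RG1] ((0.2) p.252 the Wilson action); CMP **98** (1985) 17–51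
[Balaban1985Averaging] ((8)–(9) p.19).  Elementary ([folklore]).
-/

noncomputable section

open scoped BigOperators Quaternion RealInnerProductSpace
open Literature.MathematicalPhysics.QuantumLattice (su2Quat)
open Literature.MathematicalPhysics.QuantumFieldTheory.Balaban1983to89
open Literature.MathematicalPhysics.QuantumFieldTheory.Balaban1983to89.T4CubeChartGnomonic (SU2)
open Literature.MathematicalPhysics.QuantumFieldTheory.Balaban1983to89.T4HaarSU2ExpChart (expPoint)
open Literature.MathematicalPhysics.QuantumFieldTheory.Balaban1983to89.T4ExpWindowSmallField (imVec)
open Literature.MathematicalPhysics.QuantumFieldTheory.Balaban1983to89.T4WilsonLinkAffine (bond₁ bond₂ bond₃ bond₄)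
open Literature.MathematicalPhysics.QuantumFieldTheory.Balaban1983to89.B15Prop1ChartSU2 (adSU2)
open Summit.QuantumFields.YangMills.Theorems.ApproxLift (mulField mulField_apply plaqHol_mul_left)
open Summit.QuantumFields.YangMills.Theorems.CovariantDischargeSweepActionVariation (wilsonAction4_sub_mulField_eq_sum)
open Summit.QuantumFields.YangMills.Theorems.CovariantDischargeFramedPlaquetteTransport (abs_wilsonTerm_plaq_framed_sub_le)

namespace Summit.QuantumFields.YangMills.Theorems.CovariantDischargeFramedSweepAction

variable {P : Params} {j : ℕ}

/-! ## §1 One plaquette, `mulField` letters -/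

/-- **FRAMED SWEEP, ONE PLAQUETTE.**  For `E_b = expPoint(c_b • Ad_{G(b.src)} n̂₀)` the Wilson term of `q` changes under `V ↦ E·V` by
`(1 − cos s_q)·reTr V(∂q) + sin s_q·⟨Ad_{G(x)} n̂₀, imVec(su2Quat V(∂q))⟩` up to the frame defect
`2(|c(b₂)|·dist1(G(x)⁻¹V(b₁)G(x+e_μ)) + |c(b₃)|·dist1(G(x)⁻¹(V(b₁)V(b₂)V(b₃)⁻¹)G(x+e_ν)) + |c(b₄)|·dist1 V(∂q))`, `s_q = c(b₁)+c(b₂)−c(b₃)−c(b₄)`.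
[cite: Balaban1987RG1, (0.2) p.252; Balaban1985Averaging, (8)-(9) p.19] -/
theorem abs_wilsonTerm_plaq_mulField_framed_sub_le (E V : GaugeField P j SU2) (G : Site P j → SU2) (c : PBond P j → ℝ)
    {n : EuclideanSpace ℝ (Fin 3)} (hn : ‖n‖ = 1) (hE : ∀ b, E b = expPoint (c b • adSU2 (G b.src) n)) (q : Plaq P j) :
    |((1 - reTr (GaugeField.plaqHol (mulField E V) q)) - (1 - reTr (GaugeField.plaqHol V q))) -
        ((1 - Real.cos (c (bond₁ q) + c (bond₂ q) - c (bond₃ q) - c (bond₄ q))) * reTr (GaugeField.plaqHol V q) +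
          Real.sin (c (bond₁ q) + c (bond₂ q) - c (bond₃ q) - c (bond₄ q)) *
            ⟪adSU2 (G q.src) n, imVec (su2Quat (GaugeField.plaqHol V q))⟫)| ≤
      2 * (|c (bond₂ q)| * dist1 ((G q.src)⁻¹ * V (bond₁ q) * G (q.src.shift q.μ)) +
        |c (bond₃ q)| * dist1 ((G q.src)⁻¹ * (V (bond₁ q) * V (bond₂ q) * (V (bond₃ q))⁻¹) * G (q.src.shift q.ν)) +
        |c (bond₄ q)| * dist1 (GaugeField.plaqHol V q)) := by
  have h := abs_wilsonTerm_plaq_framed_sub_le (U := V) (U' := mulField E V) q (G q.src) (G (q.src.shift q.μ))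
    (G (q.src.shift q.ν)) (G q.src) hn (c (bond₁ q)) (c (bond₂ q)) (c (bond₃ q)) (c (bond₄ q))
    (by rw [mulField_apply, hE]; rfl) (by rw [mulField_apply, hE]; rfl) (by rw [mulField_apply, hE]; rfl)
    (by rw [mulField_apply, hE]; rfl)
  have hd : dist1 ((G q.src)⁻¹ * GaugeField.plaqHol V q * G q.src) = dist1 (GaugeField.plaqHol V q) := by
    have := GaugeGroup.dist1_conj (GaugeField.plaqHol V q) (G q.src)⁻¹
    rwa [inv_inv] at this
  rw [hd] at h
  exact h

/-! ## §2 Summed over plaquettes -/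

/-- ★★ **THE ACTION CHANGE OF A FRAMED ONE-AXIS SWEEP**:
`|A(V) − A(E·V) + Σ_q [(1 − cos s_q)·reTr V(∂q) + sin s_q·⟨Ad_{G(x)} n̂₀, imVec(su2Quat V(∂q))⟩]| ≤ Σ_q def_q`.
[cite: Balaban1987RG1, (0.2) p.252] -/
theorem abs_wilsonAction4_sub_mulField_framed_le (E V : GaugeField P j SU2) (G : Site P j → SU2) (c : PBond P j → ℝ)
    {n : EuclideanSpace ℝ (Fin 3)} (hn : ‖n‖ = 1) (hE : ∀ b, E b = expPoint (c b • adSU2 (G b.src) n)) :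
    |wilsonAction4 V - wilsonAction4 (mulField E V) +
        ∑ q : Plaq P j, ((1 - Real.cos (c (bond₁ q) + c (bond₂ q) - c (bond₃ q) - c (bond₄ q))) * reTr (GaugeField.plaqHol V q) +
          Real.sin (c (bond₁ q) + c (bond₂ q) - c (bond₃ q) - c (bond₄ q)) *
            ⟪adSU2 (G q.src) n, imVec (su2Quat (GaugeField.plaqHol V q))⟫)| ≤
      ∑ q : Plaq P j, 2 * (|c (bond₂ q)| * dist1 ((G q.src)⁻¹ * V (bond₁ q) * G (q.src.shift q.μ)) +
        |c (bond₃ q)| * dist1 ((G q.src)⁻¹ * (V (bond₁ q) * V (bond₂ q) * (V (bond₃ q))⁻¹) * G (q.src.shift q.ν)) +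
        |c (bond₄ q)| * dist1 (GaugeField.plaqHol V q)) := by
  rw [wilsonAction4_sub_mulField_eq_sum, ← Finset.sum_add_distrib]
  refine (Finset.abs_sum_le_sum_abs _ _).trans (Finset.sum_le_sum fun q _ => ?_)
  have h := abs_wilsonTerm_plaq_mulField_framed_sub_le E V G c hn hE q
  rw [← plaqHol_mul_left] 
  rw [abs_sub_comm] at h
  refine le_of_eq_of_le ?_ h
  congr 1
  ring

/-- ★★ **THE `hgap`-READY LOWER BOUND**: `Σ_q [−sin s_q·⟨…⟩ − (1 − cos s_q)·reTr V(∂q)] − Σ_q def_q ≤ A(V) − A(E·V)` — undoing the framed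
sweep lowers the action by at least «−torque − cost − frame defect». [cite: Balaban1987RG1, (0.2) p.252] -/
theorem framed_lin_sub_le_wilsonAction4_sub_mulField (E V : GaugeField P j SU2) (G : Site P j → SU2) (c : PBond P j → ℝ)
    {n : EuclideanSpace ℝ (Fin 3)} (hn : ‖n‖ = 1) (hE : ∀ b, E b = expPoint (c b • adSU2 (G b.src) n)) :
    (∑ q : Plaq P j, (-(Real.sin (c (bond₁ q) + c (bond₂ q) - c (bond₃ q) - c (bond₄ q)) *
          ⟪adSU2 (G q.src) n, imVec (su2Quat (GaugeField.plaqHol V q))⟫) -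
        (1 - Real.cos (c (bond₁ q) + c (bond₂ q) - c (bond₃ q) - c (bond₄ q))) * reTr (GaugeField.plaqHol V q))) -
      ∑ q : Plaq P j, 2 * (|c (bond₂ q)| * dist1 ((G q.src)⁻¹ * V (bond₁ q) * G (q.src.shift q.μ)) +
        |c (bond₃ q)| * dist1 ((G q.src)⁻¹ * (V (bond₁ q) * V (bond₂ q) * (V (bond₃ q))⁻¹) * G (q.src.shift q.ν)) +
        |c (bond₄ q)| * dist1 (GaugeField.plaqHol V q)) ≤
      wilsonAction4 V - wilsonAction4 (mulField E V) := by
  have h := (abs_le.mp (abs_wilsonAction4_sub_mulField_framed_le E V G c hn hE)).1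
  have e : ∑ q : Plaq P j, (-(Real.sin (c (bond₁ q) + c (bond₂ q) - c (bond₃ q) - c (bond₄ q)) *
          ⟪adSU2 (G q.src) n, imVec (su2Quat (GaugeField.plaqHol V q))⟫) -
        (1 - Real.cos (c (bond₁ q) + c (bond₂ q) - c (bond₃ q) - c (bond₄ q))) * reTr (GaugeField.plaqHol V q)) =
      -∑ q : Plaq P j, ((1 - Real.cos (c (bond₁ q) + c (bond₂ q) - c (bond₃ q) - c (bond₄ q))) * reTr (GaugeField.plaqHol V q) +
          Real.sin (c (bond₁ q) + c (bond₂ q) - c (bond₃ q) - c (bond₄ q)) *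
            ⟪adSU2 (G q.src) n, imVec (su2Quat (GaugeField.plaqHol V q))⟫) := by
    rw [← Finset.sum_neg_distrib]
    exact Finset.sum_congr rfl fun q _ => by ring
  rw [e]
  linarith

/-! ## §3 Scalar letters and the quadratic form of the lower bound -/

/-- `(1 − cos s)·r ≤ s²/2` for `r ≤ 1` (`1 − cos s ∈ [0, s²/2]`). [folklore] -/
theorem one_sub_cos_mul_le_sq_half {r : ℝ} (hr : r ≤ 1) (s : ℝ) : (1 - Real.cos s) * r ≤ s ^ 2 / 2 := by
  have h0 : 0 ≤ 1 - Real.cos s := sub_nonneg.mpr (Real.cos_le_one s)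
  have h1 : 1 - Real.cos s ≤ s ^ 2 / 2 := by linarith [Real.one_sub_sq_div_two_le_cos (x := s)]
  calc (1 - Real.cos s) * r ≤ (1 - Real.cos s) * 1 := mul_le_mul_of_nonneg_left hr h0
    _ ≤ s ^ 2 / 2 := by rw [mul_one]; exact h1

/-- `|sin s − s| ≤ |s|³` for `|s| ≤ 1` (Taylor: `|sin s − (s − s³/6)| ≤ |s|⁵/100`; also landed as
`Literature.Barriers.AtomisticToContinuum.HeatConduction.abs_sin_sub_self_le`, kept private here to avoid a cross-area import). [folklore] -/
private theorem abs_sin_sub_self_le {s : ℝ} (hs : |s| ≤ 1) : |Real.sin s - s| ≤ |s| ^ 3 := by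
  have h := Real.sin_bound hs
  have h0 : 0 ≤ |s| := abs_nonneg s
  have h3 : 0 ≤ |s| ^ 3 := pow_nonneg h0 3
  have h5 : |s| ^ 5 ≤ |s| ^ 3 := by
    calc |s| ^ 5 = |s| ^ 3 * (|s| * |s|) := by ring
      _ ≤ |s| ^ 3 * (1 * 1) := by gcongr
      _ = |s| ^ 3 := by ring
  have e : Real.sin s - s = (Real.sin s - (s - s ^ 3 / 6)) + (-(s ^ 3 / 6)) := by ring
  rw [e]
  refine (abs_add_le _ _).trans ?_
  rw [abs_neg, abs_div, abs_of_pos (by norm_num : (0:ℝ) < 6), abs_pow]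
  linarith

/-- One plaquette in quadratic form: for `|s| ≤ 1`, `r ≤ 1` and any `T`,
`−s·T − |s|³·|T| − s²/2 ≤ −sin s·T − (1 − cos s)·r`. [folklore] -/
theorem quadratic_le_trig {s r : ℝ} (hs : |s| ≤ 1) (hr : r ≤ 1) (T : ℝ) :
    -s * T - |s| ^ 3 * |T| - s ^ 2 / 2 ≤ -(Real.sin s * T) - (1 - Real.cos s) * r := by
  have h1 := one_sub_cos_mul_le_sq_half hr s
  have h2 : |(Real.sin s - s) * T| ≤ |s| ^ 3 * |T| := by
    rw [abs_mul]; exact mul_le_mul_of_nonneg_right (abs_sin_sub_self_le hs) (abs_nonneg T)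
  have h3 := (abs_le.mp h2).2
  nlinarith [h1, h3]

/-- ★ **QUADRATIC `hgap`-READY LOWER BOUND**: if every curl `s_q` of the amplitude has `|s_q| ≤ 1`, then
`Σ_q [−s_q·⟨Ad_{G(x)}n̂₀, imVec(su2Quat V(∂q))⟩ − |s_q|³·|⟨…⟩| − s_q²/2] − Σ_q def_q ≤ A(V) − A(E·V)`.
[cite: Balaban1987RG1, (0.2) p.252, (0.14) p.254] -/
theorem framed_quadratic_sub_le_wilsonAction4_sub_mulField (E V : GaugeField P j SU2) (G : Site P j → SU2) (c : PBond P j → ℝ)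
    {n : EuclideanSpace ℝ (Fin 3)} (hn : ‖n‖ = 1) (hE : ∀ b, E b = expPoint (c b • adSU2 (G b.src) n))
    (hs : ∀ q : Plaq P j, |c (bond₁ q) + c (bond₂ q) - c (bond₃ q) - c (bond₄ q)| ≤ 1) :
    (∑ q : Plaq P j, (-(c (bond₁ q) + c (bond₂ q) - c (bond₃ q) - c (bond₄ q)) *
          ⟪adSU2 (G q.src) n, imVec (su2Quat (GaugeField.plaqHol V q))⟫ -
        |c (bond₁ q) + c (bond₂ q) - c (bond₃ q) - c (bond₄ q)| ^ 3 *
          |⟪adSU2 (G q.src) n, imVec (su2Quat (GaugeField.plaqHol V q))⟫| -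
        (c (bond₁ q) + c (bond₂ q) - c (bond₃ q) - c (bond₄ q)) ^ 2 / 2)) -
      ∑ q : Plaq P j, 2 * (|c (bond₂ q)| * dist1 ((G q.src)⁻¹ * V (bond₁ q) * G (q.src.shift q.μ)) +
        |c (bond₃ q)| * dist1 ((G q.src)⁻¹ * (V (bond₁ q) * V (bond₂ q) * (V (bond₃ q))⁻¹) * G (q.src.shift q.ν)) +
        |c (bond₄ q)| * dist1 (GaugeField.plaqHol V q)) ≤
      wilsonAction4 V - wilsonAction4 (mulField E V) := by
  refine le_trans ?_ (framed_lin_sub_le_wilsonAction4_sub_mulField E V G c hn hE)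
  refine sub_le_sub_right (Finset.sum_le_sum fun q _ => ?_) _
  exact quadratic_le_trig (hs q) (GaugeGroup.reTr_le_one _) _

end Summit.QuantumFields.YangMills.Theorems.CovariantDischargeFramedSweepAction

end
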